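import Literature.NumberTheory.GaloisRepresentations.QuadraticInertia
import Mathlib.Data.Rat.Lemmas
import HarnessLib

/-!
# Inertia at `p ∣ d` acts non-trivially on `√d` for a fundamental discriminant `d`:
# an element of `I_𝔓 ≤ Gal(ℚ̄/ℚ)` with `σ √d = -√d`

Topic `GaloisRepresentations`; theorems only (no definition, no named fact). This file extends the
tree's `QuadraticInertia.lean` (the case `d = p`, `exists_mem_inertia_smul_eq_neg_of_sq_eq_prime`)
from `√p` to `√d` for the integers `d` at which the quadratic field `ℚ(√d)` is ramified at `p` in
the three elementary shapes that cover every FUNDAMENTAL DISCRIMINANT `d` and every prime `p ∣ d`: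

* `p ∥ d` (`p` odd, or `p = 2` with `d ≡ 2 (mod 4)`);
* `p = 2`, `d = 4e` with `2 ∥ e` (i.e. `d = 8m'`, `m'` odd);
* `p = 2`, `d = 4m` with `m ≡ 3 (mod 4)`.

For such `(p, d)`, a finite place `v ∋ p` of `𝓞 ℚ`, a prime `𝔓` of `\bar ℤ = absIntegers (𝓞 ℚ) ℚ`
above `v` and `s ∈ ℚ̄` with `s² = d`, **some `σ ∈ I_𝔓 = 𝔓.inertia Γ_ℚ` has `σ s = -s`**
(`exists_mem_inertia_smul_eq_neg_of_sq_eq_intCast`, and the fundamental-discriminant wrapper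
`exists_mem_inertia_smul_eq_neg_of_sq_eq_fundamental` in the tree's spelling
`(d % 4 = 1 ∧ Squarefree d ∧ d ≠ 1) ∨ (4 ∣ d ∧ (d/4 % 4 = 2 ∨ d/4 % 4 = 3) ∧ Squarefree (d/4))`
of `QuadraticFields/FundamentalDiscriminant.lean`). Equivalently: the primes dividing a fundamental
discriminant `d` ramify in `ℚ(√d)` (Neukirch, *Algebraic Number Theory*, Ch. I §8, Example after
(8.3): the discriminant of `ℚ(√D)` is `D` or `4D`, and exactly the primes dividing it ramify;
Ch. I §9 (9.4)–(9.6): inertia groups; Serre, *Local Fields*, Ch. I §7 Prop. 22 (b): inertia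
surjects onto inertia).

## Proof

As in `QuadraticInertia.lean`: `E = ℚ(s)` is quadratic and normal over `ℚ` (`X² - d` is
irreducible since `d` is not a square), its conjugation `g` (`g s = -s`) lies in the inertia group
of `𝔓 ∩ E` (`mem_inertia_comap_of_apply_gen_eq_neg_intCast`), and the tree's
`exists_mem_inertia_absRestrictNormalHom_eq` lifts `g` to `I_𝔓`. The only new input is the
integrality computation showing `g x - x ∈ 𝔓` for every algebraic integer `x = c₀ + c₁ s` of `E`:
`δ = g x - x = -2c₁ s` is an algebraic integer with `δ² = M := 4c₁²d ∈ ℤ`, `δ s = N ∈ ℤ`,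
`M d = N²`, and `M = t² - 4n₀` for the integers `t = x + g x = 2c₀`, `n₀ = x · g x = c₀² - c₁²d`
(trace and norm); the elementary lemma `Int.dvd_of_sq_rel` gives `p ∣ M` in each of the three
shapes (`p ∥ d`: `p ∣ N`, `p² ∣ M d`; `d = 4e`, `2 ∥ e`: `2 ∣ N`, `M e = (N/2)²`; `d = 4m`,
`m ≡ 3 (4)`: `t` odd would give `M ≡ 1`, `M m = (N/2)² ≡ 3 (mod 4)`), hence `δ² ∈ p\bar ℤ ⊆ 𝔓`
and `δ ∈ 𝔓`.

Consumer: the Galois-currency values of Gross's rational (genus) ring class characters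
(`EllipticCurves/Gross2004/`): at the primes dividing the conductor the character is RAMIFIED,
which is read off an inertia element of `Γ_ℚ` negating `√d₁` transported to `Γ_K`.

## References

* J. Neukirch, *Algebraic Number Theory* (1999), Ch. I §8 (ramification in quadratic fields) and
  §9, (9.4)–(9.6) (inertia groups). [NeukirchANT1999]
* J.-P. Serre, *Local Fields*, GTM 67 (1979), Ch. I §7, Prop. 22 (b). [SerreLocalFields1979]

## Design

Theorems only; `namespace Literature.NumberTheory.GaloisRepresentations` (the file's path). As in
`QuadraticInertia.lean` the `ℚ`-algebra structure on `ℚ⟮s⟯` found by instance search is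
`DivisionRing.toRatAlgebra`, so the `Normal`/`FiniteDimensional` instances of the intermediate
field are passed explicitly where a generic declaration quantifies them.
-/

noncomputable section

open scoped NumberField Polynomial IntermediateField
open Polynomial Field IsDedekindDomain

namespace Literature.NumberTheory.GaloisRepresentations

/-! ### Elementary integer lemmas -/

/-- If `p ∥ e` (`p ∣ e`, `p² ∤ e`) and `M e = N²` then `p ∣ M`. [folklore] -/
private theorem Int.dvd_of_mul_eq_sq_of_dvd_not_sq_dvd {p : ℕ} (hp : p.Prime) {e M N : ℤ}
    (hpe : (p : ℤ) ∣ e) (hpe2 : ¬ (p : ℤ) ^ 2 ∣ e) (h : M * e = N ^ 2) : (p : ℤ) ∣ M := by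
  have hpi : Prime (p : ℤ) := Nat.prime_iff_prime_int.mp hp
  have hpN : (p : ℤ) ∣ N := hpi.dvd_of_dvd_pow (show (p : ℤ) ∣ N ^ 2 from h ▸ dvd_mul_of_dvd_right hpe M)
  obtain ⟨e', rfl⟩ := hpe
  obtain ⟨N', rfl⟩ := hpN
  have hp0 : (p : ℤ) ≠ 0 := by exact_mod_cast hp.ne_zero
  have h' : M * e' = p * N' ^ 2 := by
    apply mul_left_cancel₀ hp0
    calc (p : ℤ) * (M * e') = M * (p * e') := by ring
      _ = (p * N') ^ 2 := h
      _ = p * (p * N' ^ 2) := by ring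
  have hpe' : ¬ (p : ℤ) ∣ e' := fun ⟨f, hf⟩ ↦ hpe2 ⟨f, by rw [hf]; ring⟩
  rcases hpi.dvd_or_dvd (show (p : ℤ) ∣ M * e' from ⟨N' ^ 2, h'⟩) with hM | he'
  · exact hM
  · exact absurd he' hpe'

/-- Squares are `0` or `1` modulo `4`. [folklore] -/
private theorem Int.sq_emod_four_eq (z : ℤ) : z ^ 2 % 4 = 0 ∨ z ^ 2 % 4 = 1 := by
  rcases Int.even_or_odd' z with ⟨k, rfl | rfl⟩
  · left
    rw [show (2 * k) ^ 2 = 0 + 4 * k ^ 2 by ring, Int.add_mul_emod_self_left]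
    norm_num
  · right
    rw [show (2 * k + 1) ^ 2 = 1 + 4 * (k ^ 2 + k) by ring, Int.add_mul_emod_self_left]
    norm_num

/-- **The ramification arithmetic.** Let `p` be a prime and `d, M, N, t, n₀` integers with
`M d = N²` and `M = t² - 4n₀`. If `p ∥ d`, or `p = 2` and `d = 4e` with `2 ∥ e`, or `p = 2` and
`d = 4m` with `m ≡ 3 (mod 4)`, then `p ∣ M`. (Applied to `M = δ²`, `δ = gx - x` for an algebraic
integer `x` of `ℚ(√d)` of trace `t` and norm `n₀`.) [folklore] -/
private theorem Int.dvd_of_sq_rel {p : ℕ} (hp : p.Prime) {d M N t n₀ : ℤ} (hMd : M * d = N ^ 2)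
    (hMt : M = t ^ 2 - 4 * n₀)
    (hcase : ((p : ℤ) ∣ d ∧ ¬ (p : ℤ) ^ 2 ∣ d) ∨
      (p = 2 ∧ ∃ e : ℤ, d = 4 * e ∧ (2 : ℤ) ∣ e ∧ ¬ (4 : ℤ) ∣ e) ∨
      (p = 2 ∧ ∃ m : ℤ, d = 4 * m ∧ m % 4 = 3)) : (p : ℤ) ∣ M := by
  rcases hcase with ⟨h1, h2⟩ | ⟨rfl, e, rfl, he1, he2⟩ | ⟨rfl, m, rfl, hm⟩
  · exact Int.dvd_of_mul_eq_sq_of_dvd_not_sq_dvd hp h1 h2 hMd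
  · -- `d = 4e`, `2 ∥ e`: `N` is even and `M e = (N/2)²`
    have hN : (2 : ℤ) ∣ N := by
      have : (2 : ℤ) ∣ N ^ 2 := ⟨2 * (M * e), by rw [← hMd]; ring⟩
      exact Int.prime_two.dvd_of_dvd_pow this
    obtain ⟨N₁, rfl⟩ := hN
    have h' : M * e = N₁ ^ 2 := by
      have h4 : (4 : ℤ) ≠ 0 := by norm_num
      apply mul_left_cancel₀ h4
      calc (4 : ℤ) * (M * e) = M * (4 * e) := by ring
        _ = (2 * N₁) ^ 2 := hMd
        _ = 4 * N₁ ^ 2 := by ring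
    have he2' : ¬ ((2 : ℕ) : ℤ) ^ 2 ∣ e := by norm_num; exact he2
    exact Int.dvd_of_mul_eq_sq_of_dvd_not_sq_dvd Nat.prime_two (by exact_mod_cast he1) he2' h'
  · -- `d = 4m`, `m ≡ 3 (mod 4)`: `t` is even
    have hN : (2 : ℤ) ∣ N := by
      have : (2 : ℤ) ∣ N ^ 2 := ⟨2 * (M * m), by rw [← hMd]; ring⟩
      exact Int.prime_two.dvd_of_dvd_pow this
    obtain ⟨N₁, rfl⟩ := hN
    have h' : M * m = N₁ ^ 2 := by
      have h4 : (4 : ℤ) ≠ 0 := by norm_num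
      apply mul_left_cancel₀ h4
      calc (4 : ℤ) * (M * m) = M * (4 * m) := by ring
        _ = (2 * N₁) ^ 2 := hMd
        _ = 4 * N₁ ^ 2 := by ring
    rcases Int.even_or_odd' t with ⟨k, rfl | rfl⟩
    · refine ⟨2 * k ^ 2 - 2 * n₀, ?_⟩
      rw [hMt]; push_cast; ring
    · exfalso
      have hM4 : M % 4 = 1 := by
        rw [hMt, show (2 * k + 1) ^ 2 - 4 * n₀ = 1 + 4 * (k ^ 2 + k - n₀) by ring,
          Int.add_mul_emod_self_left]
        norm_num
      have hMm : (M * m) % 4 = 3 := by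
        rw [Int.mul_emod, hM4, hm]; norm_num
      rcases Int.sq_emod_four_eq N₁ with h0 | h1
      · rw [← h', hMm] at h0; exact absurd h0 (by norm_num)
      · rw [← h', hMm] at h1; exact absurd h1 (by norm_num)

/-- In each of the three ramified shapes `d` is not a perfect square. [folklore] -/
private theorem Int.not_isSquare_of_sq_rel_case {p : ℕ} (hp : p.Prime) {d : ℤ}
    (hcase : ((p : ℤ) ∣ d ∧ ¬ (p : ℤ) ^ 2 ∣ d) ∨
      (p = 2 ∧ ∃ e : ℤ, d = 4 * e ∧ (2 : ℤ) ∣ e ∧ ¬ (4 : ℤ) ∣ e) ∨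
      (p = 2 ∧ ∃ m : ℤ, d = 4 * m ∧ m % 4 = 3)) : ¬ IsSquare d := by
  rintro ⟨b, rfl⟩
  have hpi : Prime (p : ℤ) := Nat.prime_iff_prime_int.mp hp
  rcases hcase with ⟨h1, h2⟩ | ⟨rfl, e, he, he1, he2⟩ | ⟨rfl, m, hm, hm3⟩
  · have hpb : (p : ℤ) ∣ b := hpi.dvd_of_dvd_pow (show (p : ℤ) ∣ b ^ 2 by rw [sq]; exact h1)
    obtain ⟨c, rfl⟩ := hpb
    exact h2 ⟨c * c, by ring⟩
  · have h2b : (2 : ℤ) ∣ b := Int.prime_two.dvd_of_dvd_pow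
      (show (2 : ℤ) ∣ b ^ 2 by rw [sq, he]; exact ⟨2 * e, by ring⟩)
    obtain ⟨c, rfl⟩ := h2b
    have hec : e = c ^ 2 := by
      have h4 : (4 : ℤ) ≠ 0 := by norm_num
      apply mul_left_cancel₀ h4
      rw [← he]; ring
    have h2c : (2 : ℤ) ∣ c := Int.prime_two.dvd_of_dvd_pow (show (2 : ℤ) ∣ c ^ 2 by rw [← hec]; exact he1)
    obtain ⟨c', rfl⟩ := h2c
    exact he2 ⟨c' ^ 2, by rw [hec]; ring⟩
  · have h2b : (2 : ℤ) ∣ b := Int.prime_two.dvd_of_dvd_pow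
      (show (2 : ℤ) ∣ b ^ 2 by rw [sq, hm]; exact ⟨2 * m, by ring⟩)
    obtain ⟨c, rfl⟩ := h2b
    have hmc : m = c ^ 2 := by
      have h4 : (4 : ℤ) ≠ 0 := by norm_num
      apply mul_left_cancel₀ h4
      rw [← hm]; ring
    rw [hmc] at hm3
    rcases Int.sq_emod_four_eq c with h0 | h1
    · rw [h0] at hm3; exact absurd hm3 (by norm_num)
    · rw [h1] at hm3; exact absurd hm3 (by norm_num)

/-- A fundamental discriminant `d` and a prime `p ∣ d` fall in one of the three ramified shapes.
[folklore] -/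
private theorem Int.sq_rel_case_of_fundamental {p : ℕ} (hp : p.Prime) {d : ℤ}
    (hfund : (d % 4 = 1 ∧ Squarefree d ∧ d ≠ 1) ∨
      (4 ∣ d ∧ (d / 4 % 4 = 2 ∨ d / 4 % 4 = 3) ∧ Squarefree (d / 4)))
    (hpd : (p : ℤ) ∣ d) :
    ((p : ℤ) ∣ d ∧ ¬ (p : ℤ) ^ 2 ∣ d) ∨
      (p = 2 ∧ ∃ e : ℤ, d = 4 * e ∧ (2 : ℤ) ∣ e ∧ ¬ (4 : ℤ) ∣ e) ∨
      (p = 2 ∧ ∃ m : ℤ, d = 4 * m ∧ m % 4 = 3) := by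
  have hpu : ¬ IsUnit (p : ℤ) := by
    rw [Int.isUnit_iff_natAbs_eq, Int.natAbs_natCast]; exact hp.one_lt.ne'
  rcases hfund with ⟨h1, hsq, -⟩ | ⟨h4, hm, hsq⟩
  · exact Or.inl ⟨hpd, fun h ↦ hpu (hsq _ (by rw [← sq]; exact h))⟩
  · obtain ⟨m, rfl⟩ := h4
    have hm4 : 4 * m / 4 = m := by omega
    rw [hm4] at hm hsq
    rcases eq_or_ne p 2 with rfl | hp2
    · rcases hm with hm2 | hm3
      · refine Or.inr (Or.inl ⟨rfl, m, rfl, ?_, ?_⟩) <;> omega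
      · exact Or.inr (Or.inr ⟨rfl, m, rfl, hm3⟩)
    · -- odd `p ∣ 4m`: `p ∥ m`, hence `p ∥ 4m`
      have hpi : Prime (p : ℤ) := Nat.prime_iff_prime_int.mp hp
      have hp4 : ¬ (p : ℤ) ∣ 4 := by
        intro h
        have h' : (p : ℤ) ∣ 2 ^ 2 := by norm_num; exact h
        have h2 := Int.natAbs_dvd_natAbs.mpr (hpi.dvd_of_dvd_pow h')
        simp only [Int.natAbs_natCast, Int.reduceAbs, Nat.dvd_prime Nat.prime_two] at h2
        rcases h2 with h2 | h2
        · exact hp.one_lt.ne' h2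
        · exact hp2 h2
      have hpm : (p : ℤ) ∣ m := (hpi.dvd_or_dvd hpd).resolve_left hp4
      refine Or.inl ⟨hpd, fun h ↦ ?_⟩
      have hp2m : (p : ℤ) ^ 2 ∣ m := by
        obtain ⟨m₁, rfl⟩ := hpm
        have hp0 : (p : ℤ) ≠ 0 := by exact_mod_cast hp.ne_zero
        have h1 : (p : ℤ) ∣ 4 * m₁ := by
          obtain ⟨c, hc⟩ := h
          refine ⟨c, mul_left_cancel₀ hp0 ?_⟩
          calc (p : ℤ) * (4 * m₁) = 4 * (p * m₁) := by ring
            _ = p ^ 2 * c := hc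
            _ = p * (p * c) := by ring
        obtain ⟨m₂, rfl⟩ := (hpi.dvd_or_dvd h1).resolve_left hp4
        exact ⟨m₂, by ring⟩
      exact hpu (hsq _ (by rw [← sq]; exact hp2m))

/-! ### `ℚ(√d)`: degree, normality, the conjugation -/

/-- `X² - d` is irreducible over `ℚ` when the integer `d` is not a square (a rational square root
of an integer is an integer; Mathlib `Rat.isSquare_intCast_iff`). [folklore] -/
private theorem irreducible_X_sq_sub_C_intCast {d : ℤ} (hd : ¬ IsSquare d) :
    Irreducible (X ^ 2 - C (d : ℚ) : ℚ[X]) := by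
  refine (X_pow_sub_C_irreducible_iff_of_prime Nat.prime_two).mpr fun b hb ↦ hd ?_
  exact Rat.isSquare_intCast_iff.mp ⟨b, by rw [← hb, sq]⟩

section SqrtInt

variable {d : ℤ} (hd : ¬ IsSquare d) {s : AlgebraicClosure ℚ} (hs : s ^ 2 = (d : AlgebraicClosure ℚ))
include hd hs

omit hd in
/-- A square root of an integer in `ℚ̄` is integral over `ℚ`. [folklore] -/
private theorem isIntegral_of_sq_eq_intCast : IsIntegral ℚ s :=
  IsIntegral.of_pow two_pos (by
    rw [hs, ← map_intCast (algebraMap ℚ (AlgebraicClosure ℚ)) d]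
    exact isIntegral_algebraMap)

/-- For a non-square integer `d` and `s ∈ ℚ̄` with `s² = d`: `minpoly ℚ s = X² - d`. [folklore] -/
private theorem minpoly_eq_of_sq_eq_intCast : minpoly ℚ s = X ^ 2 - C (d : ℚ) := by
  refine (minpoly.eq_of_irreducible_of_monic (irreducible_X_sq_sub_C_intCast hd) ?_
    (monic_X_pow_sub_C _ two_ne_zero)).symm
  simp [hs]

/-- `[ℚ(√d) : ℚ] = 2`. [folklore] -/
private theorem finrank_adjoin_eq_two_of_sq_eq_intCast : Module.finrank ℚ ℚ⟮s⟯ = 2 := by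
  rw [IntermediateField.adjoin.finrank (isIntegral_of_sq_eq_intCast hs),
    minpoly_eq_of_sq_eq_intCast hd hs, natDegree_X_pow_sub_C]

/-- `ℚ(√d)/ℚ` is a quadratic extension (hence normal). [folklore] -/
private theorem isQuadraticExtension_adjoin_of_sq_eq_intCast : Algebra.IsQuadraticExtension ℚ ℚ⟮s⟯ :=
  { finrank_eq_two' := finrank_adjoin_eq_two_of_sq_eq_intCast hd hs }

/-- **The conjugation of `ℚ(√d)`**: an automorphism `g` of `ℚ(√d)/ℚ` with `g √d = -√d`.
[folklore] -/
private theorem exists_algEquiv_apply_gen_eq_neg_intCast :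
    ∃ g : ℚ⟮s⟯ ≃ₐ[ℚ] ℚ⟮s⟯,
      (g (IntermediateField.AdjoinSimple.gen ℚ s) : AlgebraicClosure ℚ) = -s := by
  haveI := isQuadraticExtension_adjoin_of_sq_eq_intCast hd hs
  haveI : FiniteDimensional ℚ ℚ⟮s⟯ :=
    IntermediateField.adjoin.finiteDimensional (isIntegral_of_sq_eq_intCast hs)
  have hneg : -s ∈ ℚ⟮s⟯ := neg_mem (IntermediateField.mem_adjoin_simple_self ℚ s)
  obtain ⟨g, hg⟩ := minpoly.exists_algEquiv_of_root' (K := ℚ) (L := ℚ⟮s⟯) (x := ⟨-s, hneg⟩)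
    (y := IntermediateField.AdjoinSimple.gen ℚ s) (Algebra.IsAlgebraic.isAlgebraic _) (by
      erw [IntermediateField.minpoly_gen ℚ s]
      rw [minpoly_eq_of_sq_eq_intCast hd hs]
      apply (map_eq_zero_iff _ (algebraMap ℚ⟮s⟯ (AlgebraicClosure ℚ)).injective).mp
      rw [← aeval_algebraMap_apply]
      change aeval (-s) (X ^ 2 - C (d : ℚ)) = 0
      simp [hs])
  exact ⟨g, by rw [hg]⟩

/-! ### The conjugation is an inertia element at the ramified primes -/

/-- **The conjugation of `ℚ(√d)` lies in the inertia group of a prime above `p` in the three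
ramified shapes** (`p ∥ d`; `p = 2`, `d = 4e`, `2 ∥ e`; `p = 2`, `d = 4m`, `m ≡ 3 (mod 4)`). For a
prime `𝔓` of `\bar ℤ` containing `p`, `𝔓_E = 𝔓 ∩ ℚ(√d)` and `g ∈ Aut(ℚ(√d)/ℚ)` with `g √d = -√d`:
`g ∈ I(𝔓_E)`, i.e. `g x - x ∈ 𝔓_E` for every algebraic integer `x = c₀ + c₁√d`: with
`δ = g x - x = -2c₁√d`, `δ² = M ∈ ℤ`, `δ√d = N ∈ ℤ`, `M d = N²`, `M = t² - 4n₀` (`t = 2c₀`,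
`n₀ = c₀² - c₁²d` the trace and norm of `x`), and `p ∣ M` by `Int.dvd_of_sq_rel`. This is the
ramification of `p` in `ℚ(√d)` (Neukirch, *ANT*, Ch. I §8; §9 (9.4)).
[cite: NeukirchANT1999, Ch. I §9 (9.4) with §8] -/
theorem mem_inertia_comap_of_apply_gen_eq_neg_intCast {p : ℕ} (hp : p.Prime)
    (hcase : ((p : ℤ) ∣ d ∧ ¬ (p : ℤ) ^ 2 ∣ d) ∨
      (p = 2 ∧ ∃ e : ℤ, d = 4 * e ∧ (2 : ℤ) ∣ e ∧ ¬ (4 : ℤ) ∣ e) ∨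
      (p = 2 ∧ ∃ m : ℤ, d = 4 * m ∧ m % 4 = 3))
    {𝔓 : Ideal (absIntegers (𝓞 ℚ) ℚ)} [𝔓.IsPrime]
    (hp𝔓 : algebraMap (𝓞 ℚ) (absIntegers (𝓞 ℚ) ℚ) p ∈ 𝔓) (g : ℚ⟮s⟯ ≃ₐ[ℚ] ℚ⟮s⟯)
    (hg : (g (IntermediateField.AdjoinSimple.gen ℚ s) : AlgebraicClosure ℚ) = -s) :
    g ∈ (𝔓.comap ((ℚ⟮s⟯).integralClosureToAbsIntegers (𝓞 ℚ))).inertia (ℚ⟮s⟯ ≃ₐ[ℚ] ℚ⟮s⟯) := by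
  rw [Ideal.inertia, AddSubgroup.mem_inertia]
  intro x
  rw [Submodule.mem_toAddSubgroup, Ideal.mem_comap]
  set y : absIntegers (𝓞 ℚ) ℚ := (ℚ⟮s⟯).integralClosureToAbsIntegers (𝓞 ℚ) (g • x - x)
    with hy_def
  -- the power basis `1, √d` of `ℚ(√d)`
  set pb := IntermediateField.adjoin.powerBasis (isIntegral_of_sq_eq_intCast hs)
    with hpb
  have hdim : pb.dim = 2 := by
    rw [hpb, IntermediateField.adjoin.powerBasis_dim, minpoly_eq_of_sq_eq_intCast hd hs,
      natDegree_X_pow_sub_C]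
  have hgen : algebraMap ℚ⟮s⟯ (AlgebraicClosure ℚ) pb.gen = s := by
    rw [hpb, IntermediateField.adjoin.powerBasis_gen, IntermediateField.AdjoinSimple.algebraMap_gen]
  have hggen : algebraMap ℚ⟮s⟯ (AlgebraicClosure ℚ) (g pb.gen) = -s := by
    rw [hpb, IntermediateField.adjoin.powerBasis_gen]; exact hg
  obtain ⟨f, hfdeg, hfx⟩ := pb.exists_eq_aeval (x : ℚ⟮s⟯)
  have hf : f = C (f.coeff 1) * X + C (f.coeff 0) := eq_X_add_C_of_natDegree_le_one (by omega)
  set c₁ : ℚ := f.coeff 1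
  set c₀ : ℚ := f.coeff 0
  -- coordinates: `x = c₁ √d + c₀`, `g x = -c₁ √d + c₀`
  have hxE : (x : ℚ⟮s⟯) = algebraMap ℚ ℚ⟮s⟯ c₁ * pb.gen + algebraMap ℚ ℚ⟮s⟯ c₀ := by
    rw [hfx]
    conv_lhs => rw [hf]
    simp [map_add, map_mul, aeval_C, aeval_X]
  have hgxE : g (x : ℚ⟮s⟯) = algebraMap ℚ ℚ⟮s⟯ c₁ * g pb.gen + algebraMap ℚ ℚ⟮s⟯ c₀ := by
    rw [hxE, map_add, map_mul, AlgEquiv.commutes, AlgEquiv.commutes]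
  have hxL : algebraMap ℚ⟮s⟯ (AlgebraicClosure ℚ) (x : ℚ⟮s⟯) =
      algebraMap ℚ (AlgebraicClosure ℚ) c₁ * s + algebraMap ℚ (AlgebraicClosure ℚ) c₀ := by
    rw [hxE, map_add, map_mul, hgen, ← IsScalarTower.algebraMap_apply,
      ← IsScalarTower.algebraMap_apply]
  have hgxL : algebraMap ℚ⟮s⟯ (AlgebraicClosure ℚ) (g (x : ℚ⟮s⟯)) =
      algebraMap ℚ (AlgebraicClosure ℚ) c₁ * (-s) + algebraMap ℚ (AlgebraicClosure ℚ) c₀ := by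
    rw [hgxE, map_add, map_mul, hggen, ← IsScalarTower.algebraMap_apply,
      ← IsScalarTower.algebraMap_apply]
  have hyL : (y : AlgebraicClosure ℚ) = -(2 * algebraMap ℚ (AlgebraicClosure ℚ) c₁ * s) := by
    have h1 : (y : AlgebraicClosure ℚ) = algebraMap ℚ⟮s⟯ (AlgebraicClosure ℚ)
        ((g • x - x : integralClosure (𝓞 ℚ) ℚ⟮s⟯) : ℚ⟮s⟯) := rfl
    rw [h1, AddSubgroupClass.coe_sub, integralClosure.coe_smul, map_sub, AlgEquiv.smul_def, hgxL,
      hxL]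
    ring
  -- integrality of `y`, `s`, and of `x`, `g x` (as elements of `ℚ̄`)
  have hyint : IsIntegral (𝓞 ℚ) (y : AlgebraicClosure ℚ) := y.2
  have hsint : IsIntegral (𝓞 ℚ) s := IsIntegral.of_pow two_pos (by
    rw [hs, ← map_intCast (algebraMap (𝓞 ℚ) (AlgebraicClosure ℚ)) d]
    exact isIntegral_algebraMap)
  have hxint : IsIntegral (𝓞 ℚ) (algebraMap ℚ⟮s⟯ (AlgebraicClosure ℚ) (x : ℚ⟮s⟯)) :=
    ((ℚ⟮s⟯).integralClosureToAbsIntegers (𝓞 ℚ) x).2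
  have hgxint : IsIntegral (𝓞 ℚ) (algebraMap ℚ⟮s⟯ (AlgebraicClosure ℚ) (g (x : ℚ⟮s⟯))) := by
    have h := ((ℚ⟮s⟯).integralClosureToAbsIntegers (𝓞 ℚ) (g • x)).2
    have h1 : (((ℚ⟮s⟯).integralClosureToAbsIntegers (𝓞 ℚ) (g • x) : absIntegers (𝓞 ℚ) ℚ) :
        AlgebraicClosure ℚ) = algebraMap ℚ⟮s⟯ (AlgebraicClosure ℚ)
          ((g • x : integralClosure (𝓞 ℚ) ℚ⟮s⟯) : ℚ⟮s⟯) := rfl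
    rw [h1, integralClosure.coe_smul, AlgEquiv.smul_def] at h
    exact h
  have hy2 : (y : AlgebraicClosure ℚ) ^ 2 = algebraMap ℚ (AlgebraicClosure ℚ) (4 * c₁ ^ 2 * d) := by
    rw [hyL, map_mul, map_mul, map_pow, map_intCast, map_ofNat]
    rw [show (-(2 * algebraMap ℚ (AlgebraicClosure ℚ) c₁ * s)) ^ 2 =
      4 * (algebraMap ℚ (AlgebraicClosure ℚ) c₁) ^ 2 * s ^ 2 by ring, hs]
  have hys : (y : AlgebraicClosure ℚ) * s = algebraMap ℚ (AlgebraicClosure ℚ) (-(2 * c₁ * d)) := by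
    rw [hyL, map_neg, map_mul, map_mul, map_intCast, map_ofNat]
    rw [show -(2 * algebraMap ℚ (AlgebraicClosure ℚ) c₁ * s) * s =
      -(2 * algebraMap ℚ (AlgebraicClosure ℚ) c₁ * s ^ 2) by ring, hs]
  have htr : algebraMap ℚ⟮s⟯ (AlgebraicClosure ℚ) (x : ℚ⟮s⟯) +
      algebraMap ℚ⟮s⟯ (AlgebraicClosure ℚ) (g (x : ℚ⟮s⟯)) =
        algebraMap ℚ (AlgebraicClosure ℚ) (2 * c₀) := by
    rw [hxL, hgxL, map_mul, map_ofNat]; ring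
  have hnm : algebraMap ℚ⟮s⟯ (AlgebraicClosure ℚ) (x : ℚ⟮s⟯) *
      algebraMap ℚ⟮s⟯ (AlgebraicClosure ℚ) (g (x : ℚ⟮s⟯)) =
        algebraMap ℚ (AlgebraicClosure ℚ) (c₀ ^ 2 - c₁ ^ 2 * d) := by
    rw [hxL, hgxL, map_sub, map_mul, map_pow, map_pow, map_intCast]
    rw [show (algebraMap ℚ (AlgebraicClosure ℚ) c₁ * s + algebraMap ℚ (AlgebraicClosure ℚ) c₀) *
        (algebraMap ℚ (AlgebraicClosure ℚ) c₁ * -s + algebraMap ℚ (AlgebraicClosure ℚ) c₀) =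
        (algebraMap ℚ (AlgebraicClosure ℚ) c₀) ^ 2 -
          (algebraMap ℚ (AlgebraicClosure ℚ) c₁) ^ 2 * s ^ 2 by ring, hs]
  obtain ⟨M, hM⟩ := exists_intCast_eq_of_isIntegral (q := 4 * c₁ ^ 2 * d)
    (by rw [← hy2]; exact hyint.pow 2)
  obtain ⟨N, hN⟩ := exists_intCast_eq_of_isIntegral (q := -(2 * c₁ * d))
    (by rw [← hys]; exact hyint.mul hsint)
  obtain ⟨t, ht⟩ := exists_intCast_eq_of_isIntegral (q := 2 * c₀)
    (by rw [← htr]; exact hxint.add hgxint)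
  obtain ⟨n₀, hn₀⟩ := exists_intCast_eq_of_isIntegral (q := c₀ ^ 2 - c₁ ^ 2 * d)
    (by rw [← hnm]; exact hxint.mul hgxint)
  -- `M d = N²` and `M = t² - 4 n₀` in `ℤ`, hence `p ∣ M`
  have hMd : M * d = N ^ 2 := by
    have h : ((M * d : ℤ) : ℚ) = ((N ^ 2 : ℤ) : ℚ) := by
      push_cast
      rw [hM, hN]
      ring
    exact_mod_cast h
  have hMt : M = t ^ 2 - 4 * n₀ := by
    have h : ((M : ℤ) : ℚ) = ((t ^ 2 - 4 * n₀ : ℤ) : ℚ) := by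
      push_cast
      rw [hM, ht, hn₀]
      ring
    exact_mod_cast h
  obtain ⟨k, hk⟩ := Int.dvd_of_sq_rel hp hMd hMt hcase
  -- `y² = p · k` in `\bar ℤ`, so `y² ∈ 𝔓` and `y ∈ 𝔓`
  have hy2' : y ^ 2 = algebraMap (𝓞 ℚ) (absIntegers (𝓞 ℚ) ℚ) p *
      algebraMap (𝓞 ℚ) (absIntegers (𝓞 ℚ) ℚ) (k : 𝓞 ℚ) := by
    apply Subtype.ext
    change (y : AlgebraicClosure ℚ) ^ 2 = algebraMap (𝓞 ℚ) (AlgebraicClosure ℚ) p *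
      algebraMap (𝓞 ℚ) (AlgebraicClosure ℚ) (k : 𝓞 ℚ)
    rw [hy2, ← hM, hk]
    simp only [map_intCast, map_natCast, map_mul, Int.cast_mul, Int.cast_natCast]
  have hmem2 : y ^ 2 ∈ 𝔓 := by
    rw [hy2']
    exact 𝔓.mul_mem_right _ hp𝔓
  exact Ideal.IsPrime.mem_of_pow_mem ‹𝔓.IsPrime› 2 hmem2

/-- **Inertia at `p` moves `√d` in the three ramified shapes.** For a prime `p`, an integer `d`
with `p ∥ d`, or `p = 2` and `d = 4e`, `2 ∥ e`, or `p = 2` and `d = 4m`, `m ≡ 3 (mod 4)`, a finite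
place `v ∋ p` of `𝓞 ℚ`, a prime `𝔓` of `\bar ℤ` above `v` and `s ∈ ℚ̄` with `s² = d`, some
`σ ∈ I_𝔓 ≤ Gal(ℚ̄/ℚ)` has `σ s = -s`: the conjugation of `ℚ(√d)` is an inertia element at
`𝔓 ∩ ℚ(√d)` (`mem_inertia_comap_of_apply_gen_eq_neg_intCast`), and inertia surjects onto inertia
along `ℚ̄ ⊇ ℚ(√d) ⊇ ℚ` (`exists_mem_inertia_absRestrictNormalHom_eq`, Serre, *Local Fields*,
Ch. I §7, Prop. 22 (b)). Neukirch, *ANT*, Ch. I §9, (9.4)–(9.6).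
[cite: NeukirchANT1999, Ch. I §9 (9.4)–(9.6) with §8] [cite: SerreLocalFields1979, Ch. I §7 Prop. 22(b)] -/
theorem exists_mem_inertia_smul_eq_neg_of_sq_eq_intCast {p : ℕ} (hp : p.Prime)
    (hcase : ((p : ℤ) ∣ d ∧ ¬ (p : ℤ) ^ 2 ∣ d) ∨
      (p = 2 ∧ ∃ e : ℤ, d = 4 * e ∧ (2 : ℤ) ∣ e ∧ ¬ (4 : ℤ) ∣ e) ∨
      (p = 2 ∧ ∃ m : ℤ, d = 4 * m ∧ m % 4 = 3))
    {v : HeightOneSpectrum (𝓞 ℚ)}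
    (hv : (p : 𝓞 ℚ) ∈ v.asIdeal) {𝔓 : Ideal (absIntegers (𝓞 ℚ) ℚ)} (h𝔓 : 𝔓 ∈ v.primesAbove) :
    ∃ σ ∈ 𝔓.inertia (absoluteGaloisGroup ℚ), σ • s = -s := by
  haveI : 𝔓.IsPrime := h𝔓.1
  haveI := isQuadraticExtension_adjoin_of_sq_eq_intCast hd hs
  haveI : FiniteDimensional ℚ ℚ⟮s⟯ :=
    IntermediateField.adjoin.finiteDimensional (isIntegral_of_sq_eq_intCast hs)
  have hp𝔓 : algebraMap (𝓞 ℚ) (absIntegers (𝓞 ℚ) ℚ) p ∈ 𝔓 := by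
    rw [← Ideal.mem_comap, ← Ideal.under_def, ← h𝔓.2.over]
    exact hv
  obtain ⟨g, hg⟩ := exists_algEquiv_apply_gen_eq_neg_intCast hd hs
  have hfd : FiniteDimensional ℚ ℚ⟮s⟯ := inferInstance
  have hno : Normal ℚ ℚ⟮s⟯ := Algebra.IsQuadraticExtension.normal ℚ ℚ⟮s⟯
  obtain ⟨σ, hσ, hσg⟩ := @exists_mem_inertia_absRestrictNormalHom_eq ℚ _ (𝓞 ℚ) _ _ 𝔓 _ ℚ⟮s⟯
    hfd hno g (mem_inertia_comap_of_apply_gen_eq_neg_intCast hd hs hp hcase hp𝔓 g hg)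
  refine ⟨σ, hσ, ?_⟩
  have h2 := congrArg (fun τ ↦ ((τ (IntermediateField.AdjoinSimple.gen ℚ s) : ℚ⟮s⟯) :
    AlgebraicClosure ℚ)) hσg
  have h3 := h2.trans hg
  rw [← h3]
  exact (@AlgEquiv.restrictNormalHom_apply ℚ _ (AlgebraicClosure ℚ) _ _ ℚ⟮s⟯ hno
    (absoluteGaloisGroup.toAlgEquiv ℚ σ) (IntermediateField.AdjoinSimple.gen ℚ s)).symm

end SqrtInt

/-- **Inertia at `p ∣ d` moves `√d` for a FUNDAMENTAL DISCRIMINANT `d`** (tree spelling of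
`QuadraticFields/FundamentalDiscriminant.lean`: `d ≡ 1 (mod 4)` squarefree `≠ 1`, or `d = 4m`
with `m ≡ 2, 3 (mod 4)` squarefree): for a prime `p ∣ d`, a finite place `v ∋ p` of `𝓞 ℚ`, a
prime `𝔓` of `\bar ℤ` above `v` and `s ∈ ℚ̄` with `s² = d`, some `σ ∈ I_𝔓 ≤ Gal(ℚ̄/ℚ)` has
`σ s = -s` — the primes dividing the discriminant of `ℚ(√d)` ramify (Neukirch, *ANT*, Ch. I §8,
§9 (9.4)–(9.6)). [cite: NeukirchANT1999, Ch. I §9 (9.4)–(9.6) with §8]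
[cite: SerreLocalFields1979, Ch. I §7 Prop. 22(b)] -/
theorem exists_mem_inertia_smul_eq_neg_of_sq_eq_fundamental {d : ℤ}
    (hfund : (d % 4 = 1 ∧ Squarefree d ∧ d ≠ 1) ∨
      (4 ∣ d ∧ (d / 4 % 4 = 2 ∨ d / 4 % 4 = 3) ∧ Squarefree (d / 4)))
    {p : ℕ} (hp : p.Prime) (hpd : (p : ℤ) ∣ d)
    {s : AlgebraicClosure ℚ} (hs : s ^ 2 = (d : AlgebraicClosure ℚ))
    {v : HeightOneSpectrum (𝓞 ℚ)} (hv : (p : 𝓞 ℚ) ∈ v.asIdeal)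
    {𝔓 : Ideal (absIntegers (𝓞 ℚ) ℚ)} (h𝔓 : 𝔓 ∈ v.primesAbove) :
    ∃ σ ∈ 𝔓.inertia (absoluteGaloisGroup ℚ), σ • s = -s :=
  have hcase := Int.sq_rel_case_of_fundamental hp hfund hpd
  exists_mem_inertia_smul_eq_neg_of_sq_eq_intCast (Int.not_isSquare_of_sq_rel_case hp hcase) hs hp
    hcase hv h𝔓

end Literature.NumberTheory.GaloisRepresentations

end
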